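import Mathlib.Algebra.Group.Subgroup.Finite
import Mathlib.Algebra.Group.Subgroup.ZPowers.Lemmas
import Mathlib.Algebra.BigOperators.Group.Finset.Basic
import Mathlib.GroupTheory.OrderOfElement
import Mathlib.Tactic
import HarnessLib

/-!
# Cube pair alignment: `t` and `t′` generate `A` (parity lemma)

ω-census, family (b3).  Framing: lottery ticket; floor = certified bounds/negative ranges.

Lemma Q of `FAMILY-B-ADDENDUM-g4.md` §7, Step 1, the generation statement: if `M ⊔ (M+t) ⊔ P ⊔ (P+t′) = A ∖ {x₀}`
(indicator form (i) of `aligned_of_generator`) and `|A|` is odd, then `⟨t, t′⟩ = A`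
(**`closure_pair_eq_top_of_near_tiling`**): a coset `C` of `B = ⟨t, t′⟩` avoiding `x₀` is `t`- and `t′`-invariant, so
summing (i) over `C` gives `|C| = 2(|C ∩ M| + |C ∩ P|)`, even, while `|C| = |B|` divides the odd `|A|`.  Since `|A|` is
odd, also `⟨t′ − t⟩ + ⟨t + t′⟩ = A` (**`zmultiples_sup_zmultiples_eq_top_of_near_tiling`**), the input of the last case
of Lemma Q (with `CubePairSubgroupsDisjoint.lean`: the sum is direct).
-/

namespace Summit.MatrixMultiplication.OmegaCensus

open Finset

section Closure

variable {A : Type*} [AddCommGroup A] [Fintype A] [DecidableEq A]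

/-- **Parity lemma.** The near-tiling (i) with `|A|` odd forces `⟨t, t′⟩ = A`. [folklore] -/
theorem closure_pair_eq_top_of_near_tiling {M P : Finset A} {t t' x₀ : A}
    (hi : ∀ y : A, ((if y ∈ M then (1 : ℤ) else 0) + (if y - t ∈ M then 1 else 0) + (if y ∈ P then 1 else 0) +
      (if y - t' ∈ P then 1 else 0)) = if y = x₀ then 0 else 1)
    (hodd : Odd (Fintype.card A)) :
    AddSubgroup.closure ({t, t'} : Set A) = ⊤ := by
  classical
  set B := AddSubgroup.closure ({t, t'} : Set A) with hB
  have htB : t ∈ B := AddSubgroup.subset_closure (by simp)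
  have ht'B : t' ∈ B := AddSubgroup.subset_closure (by simp)
  -- every coset of `B` contains `x₀`
  have key : ∀ y₁ : A, y₁ - x₀ ∈ B := by
    intro y₁
    by_contra hy₁
    set C := univ.filter fun y : A => y - y₁ ∈ B with hC
    have hx₀C : x₀ ∉ C := by
      intro h
      rw [hC, mem_filter] at h
      exact hy₁ (by have := B.neg_mem h.2; rwa [neg_sub] at this)
    have hCs : ∀ y s : A, s ∈ B → (y ∈ C ↔ y + s ∈ C) := by
      intro y s hs
      simp only [hC, mem_filter, mem_univ, true_and]
      rw [show y + s - y₁ = (y - y₁) + s by abel]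
      exact ⟨fun h => B.add_mem h hs, fun h => by simpa using B.sub_mem h hs⟩
    -- summing (i) over `C`
    have hone : ∀ y ∈ C, (if y = x₀ then (0 : ℤ) else 1) = 1 :=
      fun y hy => if_neg fun h : y = x₀ => hx₀C (h ▸ hy)
    have hsum : ∑ y ∈ C, (((if y ∈ M then (1 : ℤ) else 0) + (if y - t ∈ M then 1 else 0) +
        (if y ∈ P then 1 else 0) + (if y - t' ∈ P then 1 else 0))) = C.card := by
      rw [sum_congr rfl fun y hy => (hi y).trans (hone y hy)]
      simp
    have shiftM : ∑ y ∈ C, (if y - t ∈ M then (1 : ℤ) else 0) = ∑ y ∈ C, (if y ∈ M then (1 : ℤ) else 0) := by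
      refine sum_nbij' (· - t) (· + t) ?_ ?_ ?_ ?_ ?_
      · intro y hy; rw [sub_eq_add_neg]; exact (hCs y (-t) (B.neg_mem htB)).1 hy
      · intro y hy; exact (hCs y t htB).1 hy
      · intro y _; simp
      · intro y _; simp
      · intro y _; rfl
    have shiftP : ∑ y ∈ C, (if y - t' ∈ P then (1 : ℤ) else 0) = ∑ y ∈ C, (if y ∈ P then (1 : ℤ) else 0) := by
      refine sum_nbij' (· - t') (· + t') ?_ ?_ ?_ ?_ ?_
      · intro y hy; rw [sub_eq_add_neg]; exact (hCs y (-t') (B.neg_mem ht'B)).1 hy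
      · intro y hy; exact (hCs y t' ht'B).1 hy
      · intro y _; simp
      · intro y _; simp
      · intro y _; rfl
    rw [sum_add_distrib, sum_add_distrib, sum_add_distrib, shiftM, shiftP] at hsum
    -- `|C| = |B|` divides `|A|`, odd
    have hCB : C.card = (univ.filter fun y : A => y ∈ B).card := by
      refine card_nbij' (· - y₁) (· + y₁) ?_ ?_ ?_ ?_
      · intro y hy
        rw [hC, mem_coe, mem_filter] at hy
        rw [mem_coe, mem_filter]; exact ⟨mem_univ _, hy.2⟩
      · intro y hy
        rw [mem_coe, mem_filter] at hy
        rw [hC, mem_coe, mem_filter]; exact ⟨mem_univ _, by simpa using hy.2⟩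
      · intro y _; simp
      · intro y _; simp
    have hBcard : (univ.filter fun y : A => y ∈ B).card = Nat.card B := by
      rw [Nat.card_eq_fintype_card, Fintype.card_subtype]
    have hdvd : Nat.card B ∣ Fintype.card A := by
      rw [← Nat.card_eq_fintype_card]; exact AddSubgroup.card_addSubgroup_dvd_card B
    obtain ⟨q, hq⟩ := hdvd
    rw [← hBcard, ← hCB] at hq
    -- `C.card` is even by `hsum` and odd by `hq`
    have hCodd : Odd C.card := by
      have : Odd (C.card * q) := by rw [← hq]; exact hodd
      exact (Nat.odd_mul.1 this).1
    obtain ⟨j, hj⟩ := hCodd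
    have h0M : 0 ≤ ∑ y ∈ C, (if y ∈ M then (1 : ℤ) else 0) := sum_nonneg fun y _ => by split_ifs <;> norm_num
    have h0P : 0 ≤ ∑ y ∈ C, (if y ∈ P then (1 : ℤ) else 0) := sum_nonneg fun y _ => by split_ifs <;> norm_num
    omega
  rw [eq_top_iff]
  intro x _
  have := key (x + x₀)
  rwa [add_sub_cancel_right] at this

/-- With `|A|` odd, `⟨t′ − t⟩ + ⟨t + t′⟩ ⊇ ⟨t, t′⟩`; hence under (i): `⟨t′ − t⟩ ⊔ ⟨t + t′⟩ = ⊤`. [folklore] -/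
theorem zmultiples_sup_zmultiples_eq_top_of_near_tiling {M P : Finset A} {t t' x₀ : A}
    (hi : ∀ y : A, ((if y ∈ M then (1 : ℤ) else 0) + (if y - t ∈ M then 1 else 0) + (if y ∈ P then 1 else 0) +
      (if y - t' ∈ P then 1 else 0)) = if y = x₀ then 0 else 1)
    (hodd : Odd (Fintype.card A)) :
    AddSubgroup.zmultiples (t' - t) ⊔ AddSubgroup.zmultiples (t + t') = ⊤ := by
  set B' := AddSubgroup.zmultiples (t' - t) ⊔ AddSubgroup.zmultiples (t + t') with hB'
  have hu : t' - t ∈ B' := AddSubgroup.mem_sup_left (AddSubgroup.mem_zmultiples _)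
  have hv : t + t' ∈ B' := AddSubgroup.mem_sup_right (AddSubgroup.mem_zmultiples _)
  obtain ⟨r, hr⟩ := hodd
  -- halving: `(r + 1) • (2 • x) = x`
  have half : ∀ x : A, (r + 1) • (2 • x) = x := by
    intro x
    have hNx : Fintype.card A • x = 0 := addOrderOf_dvd_iff_nsmul_eq_zero.1 addOrderOf_dvd_card
    rw [smul_smul, show (r + 1) * 2 = Fintype.card A + 1 by omega, succ_nsmul, hNx, zero_add]
  have h2t : 2 • t ∈ B' := by
    have : 2 • t = (t + t') - (t' - t) := by rw [two_nsmul]; abel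
    rw [this]; exact B'.sub_mem hv hu
  have h2t' : 2 • t' ∈ B' := by
    have : 2 • t' = (t + t') + (t' - t) := by rw [two_nsmul]; abel
    rw [this]; exact B'.add_mem hv hu
  have ht : t ∈ B' := by rw [← half t]; exact B'.nsmul_mem h2t _
  have ht' : t' ∈ B' := by rw [← half t']; exact B'.nsmul_mem h2t' _
  have hle : AddSubgroup.closure ({t, t'} : Set A) ≤ B' := by
    rw [AddSubgroup.closure_le]
    intro x hx
    rcases Set.mem_insert_iff.1 hx with rfl | hx
    · exact ht
    · rw [Set.mem_singleton_iff.1 hx]; exact ht'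
  rw [closure_pair_eq_top_of_near_tiling hi ⟨r, hr⟩] at hle
  exact top_le_iff.1 hle

/-- Element form: under (i) with `|A|` odd, every `y` is `a + b` with `a ∈ ⟨t′ − t⟩`, `b ∈ ⟨t + t′⟩`. [folklore] -/
theorem exists_add_eq_of_near_tiling {M P : Finset A} {t t' x₀ : A}
    (hi : ∀ y : A, ((if y ∈ M then (1 : ℤ) else 0) + (if y - t ∈ M then 1 else 0) + (if y ∈ P then 1 else 0) +
      (if y - t' ∈ P then 1 else 0)) = if y = x₀ then 0 else 1)
    (hodd : Odd (Fintype.card A)) (y : A) :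
    ∃ a ∈ AddSubgroup.zmultiples (t' - t), ∃ b ∈ AddSubgroup.zmultiples (t + t'), a + b = y := by
  have h : y ∈ AddSubgroup.zmultiples (t' - t) ⊔ AddSubgroup.zmultiples (t + t') := by
    rw [zmultiples_sup_zmultiples_eq_top_of_near_tiling hi hodd]; exact AddSubgroup.mem_top y
  exact AddSubgroup.mem_sup.1 h

end Closure

end Summit.MatrixMultiplication.OmegaCensus
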